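import Summits.AnomalousDissipation.AnomalousDissipation.Theorems.SolenoidalFractalHomogenisationLagrangianStepSidebandXEnergy
import Summits.AnomalousDissipation.AnomalousDissipation.Theorems.SolenoidalFractalHomogenisationLagrangianStepSidebandResponseExtContinuous
import Summits.AnomalousDissipation.AnomalousDissipation.Theorems.SolenoidalFractalHomogenisationLagrangianStepRightGronwall
import HarnessLib

/-!
# K1L_D `LagrangianRenormalisationStepDesign` (stmt-AnomalousDissipation-27980), `stub_D1_V0` (V0 = clause (ii) of
# `WCrossing.D1ExactFamily`), brick T4d: THE RESIDUAL ENERGY DECAYS — `‖r t‖² ≤ e^{−σt}‖r 0‖² + ∫₀ᵗ e^{−σ(t−s)} C·(ξ²‖y‖² + ξ⁴‖x‖² + ξ⁴‖Z‖² + tailEnergy) ds`,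
# `σ = π²lo/2`, on the whole life span `[0,T]` (helper; `--kind proof --supports stmt-AnomalousDissipation-27980 --as helper`)

Summits-side helper file of route `SolenoidalFractalHomogenisation` (prover seat `ad-k1l-cellLawV-w1` g7; 0 sorry, no defs, no named facts).  Brick T4d =
W7-2 of the cell lead's TAKES-w1-g7 menu (memo `Cruxes/LagrangianRenormalisationStepDesign/Lines/onelevel-V0-residual.md` §3 «Result (T4 final)»): the
pointwise energy inequality `…SidebandXEnergy.residualX_energy_ineq` (right derivative of `‖r‖²` on `(0,T)`) is closed by the forced Grönwall lemma from
the right `…RightGronwall.le_exp_of_deriv_right_le` on every `[a,T]`, `a > 0`, and the window start is sent to `0⁺` by continuity of all objects on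
`[0,T]` (`CellChain.continuousOn_modeRep`, `continuous_responseExt`).
* `continuousOn_sbVec`, `continuousOn_refState`, `continuousOn_residualX`, `continuousOn_tailEnergy` — continuity on `[0,T]`;
* `residualX_norm_sq_le_of_pos` — the decay estimate from any window start `a ∈ (0,T)`;
* **`residualX_norm_sq_le`** — the decay estimate from `0`: for `t ∈ [0,T]`,
  `‖r t‖² ≤ e^{−(π²lo/2)t}‖r 0‖² + ∫₀ᵗ e^{−(π²lo/2)(t−s)}·C·(ξ²‖y s‖² + ξ⁴‖x s‖² + ξ⁴‖Z s‖² + tailEnergy s) ds`, same `C = C(W₁, lo, hi, β)`.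
NOT a proof of any registered stub, of K1L_D, or of anomalous dissipation; rung F-D1.A0 infrastructure.
-/

set_option linter.dupNamespace false

noncomputable section

namespace Summit.AnomalousDissipation.AnomalousDissipation.Theorems.SolenoidalFractalHomogenisation.LagrangianStep.Sideband

open Set MeasureTheory Complex UnitAddTorus Filter Topology intervalIntegral
open scoped InnerProductSpace
open Literature.Analysis Literature.Analysis.FunctionSpaces Literature.Analysis.FunctionSpaces.Torus
open Literature.Analysis.FluidPDE Literature.Analysis.FluidPDE.Torus Literature.Analysis.FluidPDE.LatticeShear
open Summit.AnomalousDissipation.AnomalousDissipation.Theorems.SolenoidalFractalHomogenisation.LagrangianStep.CellChain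
  (modeRep continuousOn_modeRep)
open Summit.AnomalousDissipation.AnomalousDissipation.Theorems.SolenoidalFractalHomogenisation.LagrangianStep.RightGronwall
  (le_exp_of_deriv_right_le)

variable {k₀ : ℕ}

/-! ## §1 Continuity of the objects on `[0,T]` -/

/-- **The box vector is continuous on `[0,T]`.** [cite: Temam1984, Ch. III §1.1] -/
theorem continuousOn_sbVec (W₁ : LatticeWord k₀) (n : ℕ) {T : ℝ} (hT : 0 ≤ T) {𝔹 : Torus.Visc4 (Fin 3)}
    {F : UnitAddTorus (Fin 3) → EuclideanSpace ℝ (Fin 3)} {u : ℝ → UnitAddTorus (Fin 3) → EuclideanSpace ℝ (Fin 3)}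
    (h : Torus.IsWeakTensorPassiveVectorOn 0 T 𝔹 (W₁.cell n) F u) (ℓ : Fin 3 → ℤ) (R : ℕ) :
    ContinuousOn (sbVec W₁ n 𝔹 F u ℓ R) (Icc 0 T) := by
  have hfun : sbVec W₁ n 𝔹 F u ℓ R = (WithLp.toLp 2) ∘ fun t (z : box R) => modeRep W₁ n 𝔹 F u (classFreq n ℓ z.1) t := rfl
  rw [hfun]
  exact (PiLp.continuous_toLp 2 _).comp_continuousOn (continuousOn_pi.2 fun z => continuousOn_modeRep W₁ n hT h _)

/-- **The reference state is continuous on `[0,T]`.** [cite: SandersVerhulstMurdock2007, Lemma 5.2.7 (linear case)] -/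
theorem continuousOn_refState (W₁ : LatticeWord k₀) {n : ℕ} (ℓ : Fin 3 → ℤ) {𝔸 : Torus.Visc4 (Fin 3)} {lo hi : ℝ}
    (h𝔸 : Torus.NearIso 𝔸 lo hi) (hlo : 0 < lo) (R : ℕ) {T : ℝ} (hT : 0 ≤ T)
    {F : UnitAddTorus (Fin 3) → EuclideanSpace ℝ (Fin 3)} {w : ℝ → UnitAddTorus (Fin 3) → EuclideanSpace ℝ (Fin 3)}
    (h : Torus.IsWeakTensorPassiveVectorOn 0 T ((1 / (n : ℝ) ^ 2) • 𝔸) (W₁.cell n) F w) :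
    ContinuousOn (refState W₁ n ℓ 𝔸 R F w) (Icc 0 T) := by
  have hN : ∀ j, IsPeriodicResponse W₁ 𝔸 1 R j (response W₁ 𝔸 1 R j) := fun j => isPeriodicResponse_response_of_nearIso W₁ h𝔸 hlo one_pos R j
  have hfun : refState W₁ n ℓ 𝔸 R F w = fun t =>
      ∑ j, ((xiCoeff W₁ n ℓ j : ℝ) : ℂ) • responseExt W₁ 𝔸 1 R j t (modeRep W₁ n ((1 / (n : ℝ) ^ 2) • 𝔸) F w ℓ t) := rfl
  rw [hfun]
  refine continuousOn_finsetSum _ fun j _ => ?_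
  have hj : ContinuousOn (fun t => responseExt W₁ 𝔸 1 R j t (modeRep W₁ n ((1 / (n : ℝ) ^ 2) • 𝔸) F w ℓ t)) (Icc 0 T) :=
    ContinuousOn.clm_apply (continuousOn_responseExt W₁ 𝔸 1 R j (hN j) _) (continuousOn_modeRep W₁ n hT h ℓ)
  exact hj.const_smul (((xiCoeff W₁ n ℓ j : ℝ) : ℂ))

/-- **The residual is continuous on `[0,T]`.** [cite: SandersVerhulstMurdock2007, Lemma 5.2.7 (linear case)] -/
theorem continuousOn_residualX (W₁ : LatticeWord k₀) {n : ℕ} (ℓ : Fin 3 → ℤ) {𝔸 : Torus.Visc4 (Fin 3)} {lo hi : ℝ}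
    (h𝔸 : Torus.NearIso 𝔸 lo hi) (hlo : 0 < lo) (R : ℕ) {T : ℝ} (hT : 0 ≤ T)
    {F : UnitAddTorus (Fin 3) → EuclideanSpace ℝ (Fin 3)} {w : ℝ → UnitAddTorus (Fin 3) → EuclideanSpace ℝ (Fin 3)}
    (h : Torus.IsWeakTensorPassiveVectorOn 0 T ((1 / (n : ℝ) ^ 2) • 𝔸) (W₁.cell n) F w) :
    ContinuousOn (residualX W₁ n ℓ 𝔸 R F w) (Icc 0 T) := by
  have hfun : residualX W₁ n ℓ 𝔸 R F w = fun t =>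
      sbVec W₁ n ((1 / (n : ℝ) ^ 2) • 𝔸) F w ℓ R t - projX n ℓ R (refState W₁ n ℓ 𝔸 R F w t) := rfl
  rw [hfun]
  exact (continuousOn_sbVec W₁ n hT h ℓ R).sub
    ((projX n ℓ R).continuous.comp_continuousOn (continuousOn_refState W₁ ℓ h𝔸 hlo R hT h))

/-- **The outside-tail energy is continuous on `[0,T]`.** [cite: Temam1984, Ch. III §1.1] -/
theorem continuousOn_tailEnergy (W₁ : LatticeWord k₀) (n : ℕ) (ℓ : Fin 3 → ℤ) (𝔸 : Torus.Visc4 (Fin 3)) (R : ℕ) {T : ℝ} (hT : 0 ≤ T)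
    {F : UnitAddTorus (Fin 3) → EuclideanSpace ℝ (Fin 3)} {w : ℝ → UnitAddTorus (Fin 3) → EuclideanSpace ℝ (Fin 3)}
    (h : Torus.IsWeakTensorPassiveVectorOn 0 T ((1 / (n : ℝ) ^ 2) • 𝔸) (W₁.cell n) F w) :
    ContinuousOn (tailEnergy W₁ n ℓ 𝔸 R F w) (Icc 0 T) := by
  have hite : ∀ (P : Prop) [Decidable P] (k : Fin 3 → ℤ),
      ContinuousOn (fun t => (if P then modeRep W₁ n ((1 / (n : ℝ) ^ 2) • 𝔸) F w k t else 0)) (Icc 0 T) := by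
    intro P _ k
    by_cases hP : P
    · simp only [hP, if_true]; exact continuousOn_modeRep W₁ n hT h k
    · simp only [hP, if_false]; exact continuousOn_const
  have hfun : tailEnergy W₁ n ℓ 𝔸 R F w = fun t => ∑ z : box R, (∑ j, ‖slotAmp W₁ j‖ *
      (‖(if (z.1 - (W₁.phase j).m ∉ box R ∧ z.1 - (W₁.phase j).m ≠ 0) then
          modeRep W₁ n ((1 / (n : ℝ) ^ 2) • 𝔸) F w (classFreq n ℓ (z.1 - (W₁.phase j).m)) t else 0)‖ +
       ‖(if (z.1 + (W₁.phase j).m ∉ box R ∧ z.1 + (W₁.phase j).m ≠ 0) then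
          modeRep W₁ n ((1 / (n : ℝ) ^ 2) • 𝔸) F w (classFreq n ℓ (z.1 + (W₁.phase j).m)) t else 0)‖)) ^ 2 :=
    funext fun t => tailEnergy_def W₁ n ℓ 𝔸 R F w t
  rw [hfun]
  refine continuousOn_finsetSum _ fun z _ => ContinuousOn.pow (continuousOn_finsetSum _ fun j _ => ?_) 2
  exact continuousOn_const.mul (((hite _ _).norm).add ((hite _ _).norm))

/-! ## §2 The decay estimate from a positive window start -/

/-- **Decay of the residual energy from any `a ∈ (0,T)`**: for `t ∈ [a,T]`,
`‖r t‖² ≤ e^{−(π²lo/2)(t−a)}‖r a‖² + ∫ₐᵗ e^{−(π²lo/2)(t−s)}·C·(ξ²‖y s‖² + ξ⁴‖x s‖² + ξ⁴‖Z s‖² + tailEnergy s) ds`.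
[cite: BedrossianCotiZelati2017, §2] [cite: SandersVerhulstMurdock2007, Lemma 5.2.7 (linear case)] -/
theorem residualX_norm_sq_le_of_pos (W₁ : LatticeWord k₀) {lo hi β : ℝ} (hlo : 0 < lo) (hhi : 0 ≤ hi) (hβ : 0 ≤ β) :
    ∃ C : ℝ, 0 ≤ C ∧ ∀ {n : ℕ}, n ≠ 0 → ∀ {𝔸 : Torus.Visc4 (Fin 3)}, Torus.NearIso 𝔸 lo hi → Torus.OddSmall 𝔸 β →
      ∀ {T : ℝ} {F : UnitAddTorus (Fin 3) → EuclideanSpace ℝ (Fin 3)} {w : ℝ → UnitAddTorus (Fin 3) → EuclideanSpace ℝ (Fin 3)},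
      Torus.IsWeakTensorPassiveVectorOn 0 T ((1 / (n : ℝ) ^ 2) • 𝔸) (W₁.cell n) F w → Integrable F volume →
      ∀ {ℓ : Fin 3 → ℤ}, 2 * Real.sqrt (freqNormSq ℓ) ≤ n → ∀ {R : ℕ}, (∀ j, (W₁.phase j).m ∈ box R) →
      ∀ {a : ℝ}, a ∈ Ioo 0 T → ∀ {t : ℝ}, t ∈ Icc a T →
        ‖residualX W₁ n ℓ 𝔸 R F w t‖ ^ 2 ≤
          Real.exp (-(Real.pi ^ 2 * lo / 2 * (t - a))) * ‖residualX W₁ n ℓ 𝔸 R F w a‖ ^ 2 +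
          ∫ s in a..t, Real.exp (-(Real.pi ^ 2 * lo / 2 * (t - s))) *
            (C * ((Real.sqrt (freqNormSq ℓ) / n) ^ 2 * ‖refState W₁ n ℓ 𝔸 R F w s‖ ^ 2 +
                 (Real.sqrt (freqNormSq ℓ) / n) ^ 4 * ‖modeRep W₁ n ((1 / (n : ℝ) ^ 2) • 𝔸) F w ℓ s‖ ^ 2 +
                 (Real.sqrt (freqNormSq ℓ) / n) ^ 4 * ‖sbVec W₁ n ((1 / (n : ℝ) ^ 2) • 𝔸) F w ℓ R s‖ ^ 2 +
                 tailEnergy W₁ n ℓ 𝔸 R F w s)) := by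
  obtain ⟨C, hC0, hC⟩ := residualX_energy_ineq W₁ hlo hhi hβ
  refine ⟨C, hC0, ?_⟩
  intro n hn 𝔸 h𝔸 hodd T F w h hF ℓ hℓ R hbox a ha t ht
  have hT : 0 < T := ha.1.trans ha.2
  -- the right derivative on `[a,T)`
  have hex : ∀ s ∈ Ico a T, ∃ φ : ℝ, HasDerivWithinAt (fun τ => ‖residualX W₁ n ℓ 𝔸 R F w τ‖ ^ 2) φ (Ici s) s ∧
      φ ≤ -(Real.pi ^ 2 * lo / 2) * ‖residualX W₁ n ℓ 𝔸 R F w s‖ ^ 2 +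
        C * ((Real.sqrt (freqNormSq ℓ) / n) ^ 2 * ‖refState W₁ n ℓ 𝔸 R F w s‖ ^ 2 +
             (Real.sqrt (freqNormSq ℓ) / n) ^ 4 * ‖modeRep W₁ n ((1 / (n : ℝ) ^ 2) • 𝔸) F w ℓ s‖ ^ 2 +
             (Real.sqrt (freqNormSq ℓ) / n) ^ 4 * ‖sbVec W₁ n ((1 / (n : ℝ) ^ 2) • 𝔸) F w ℓ R s‖ ^ 2 +
             tailEnergy W₁ n ℓ 𝔸 R F w s) :=
    fun s hs => hC hn h𝔸 hodd h hF hℓ hbox ⟨ha.1.trans_le hs.1, hs.2⟩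
  choose! φ hφ using hex
  -- continuity on `[a,T]`
  have hsub : Icc a T ⊆ Icc 0 T := Icc_subset_Icc_left ha.1.le
  have hΦc : ContinuousOn (fun τ => ‖residualX W₁ n ℓ 𝔸 R F w τ‖ ^ 2) (Icc a T) :=
    (((continuousOn_residualX W₁ ℓ h𝔸 hlo R hT.le h).mono hsub).norm).pow 2
  have hgc : ContinuousOn (fun s => C * ((Real.sqrt (freqNormSq ℓ) / n) ^ 2 * ‖refState W₁ n ℓ 𝔸 R F w s‖ ^ 2 +
      (Real.sqrt (freqNormSq ℓ) / n) ^ 4 * ‖modeRep W₁ n ((1 / (n : ℝ) ^ 2) • 𝔸) F w ℓ s‖ ^ 2 +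
      (Real.sqrt (freqNormSq ℓ) / n) ^ 4 * ‖sbVec W₁ n ((1 / (n : ℝ) ^ 2) • 𝔸) F w ℓ R s‖ ^ 2 +
      tailEnergy W₁ n ℓ 𝔸 R F w s)) (Icc a T) := by
    refine continuousOn_const.mul ((((continuousOn_const.mul ?_).add (continuousOn_const.mul ?_)).add
      (continuousOn_const.mul ?_)).add ?_)
    · exact (((continuousOn_refState W₁ ℓ h𝔸 hlo R hT.le h).mono hsub).norm).pow 2
    · exact (((continuousOn_modeRep W₁ n hT.le h ℓ).mono hsub).norm).pow 2
    · exact (((continuousOn_sbVec W₁ n hT.le h ℓ R).mono hsub).norm).pow 2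
    · exact (continuousOn_tailEnergy W₁ n ℓ 𝔸 R hT.le h).mono hsub
  exact le_exp_of_deriv_right_le hΦc (fun s hs => (hφ s hs).1) hgc (fun s hs => (hφ s hs).2) t ht

/-! ## §3 The decay estimate from `0` -/

/-- **DECAY OF THE RESIDUAL ENERGY (T4d)**: there is `C = C(W₁, lo, hi, β) ≥ 0` such that for every cell number `n ≥ 1`, tensor `𝔸` with
`NearIso 𝔸 lo hi`, `OddSmall 𝔸 β`, weak solution `w` of the flat tensor cell problem (`𝔹 = (1/n²)•𝔸`, datum `F`), slow mode with `2|ℓ| ≤ n`,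
truncation `R` retaining every `±mⱼ`, and `t ∈ [0,T]`:
`‖r t‖² ≤ e^{−(π²lo/2)t}‖r 0‖² + ∫₀ᵗ e^{−(π²lo/2)(t−s)}·C·(ξ²‖y s‖² + ξ⁴‖x s‖² + ξ⁴‖Z s‖² + tailEnergy s) ds`.
[cite: BedrossianCotiZelati2017, §2] [cite: SandersVerhulstMurdock2007, Lemma 5.2.7 (linear case)] [cite: Temam1984, Ch. III §1 Lemma 1.2 (energy inequality)] -/
theorem residualX_norm_sq_le (W₁ : LatticeWord k₀) {lo hi β : ℝ} (hlo : 0 < lo) (hhi : 0 ≤ hi) (hβ : 0 ≤ β) :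
    ∃ C : ℝ, 0 ≤ C ∧ ∀ {n : ℕ}, n ≠ 0 → ∀ {𝔸 : Torus.Visc4 (Fin 3)}, Torus.NearIso 𝔸 lo hi → Torus.OddSmall 𝔸 β →
      ∀ {T : ℝ} {F : UnitAddTorus (Fin 3) → EuclideanSpace ℝ (Fin 3)} {w : ℝ → UnitAddTorus (Fin 3) → EuclideanSpace ℝ (Fin 3)},
      Torus.IsWeakTensorPassiveVectorOn 0 T ((1 / (n : ℝ) ^ 2) • 𝔸) (W₁.cell n) F w → Integrable F volume →
      ∀ {ℓ : Fin 3 → ℤ}, 2 * Real.sqrt (freqNormSq ℓ) ≤ n → ∀ {R : ℕ}, (∀ j, (W₁.phase j).m ∈ box R) →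
      ∀ {t : ℝ}, t ∈ Icc 0 T →
        ‖residualX W₁ n ℓ 𝔸 R F w t‖ ^ 2 ≤
          Real.exp (-(Real.pi ^ 2 * lo / 2 * t)) * ‖residualX W₁ n ℓ 𝔸 R F w 0‖ ^ 2 +
          ∫ s in (0:ℝ)..t, Real.exp (-(Real.pi ^ 2 * lo / 2 * (t - s))) *
            (C * ((Real.sqrt (freqNormSq ℓ) / n) ^ 2 * ‖refState W₁ n ℓ 𝔸 R F w s‖ ^ 2 +
                 (Real.sqrt (freqNormSq ℓ) / n) ^ 4 * ‖modeRep W₁ n ((1 / (n : ℝ) ^ 2) • 𝔸) F w ℓ s‖ ^ 2 +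
                 (Real.sqrt (freqNormSq ℓ) / n) ^ 4 * ‖sbVec W₁ n ((1 / (n : ℝ) ^ 2) • 𝔸) F w ℓ R s‖ ^ 2 +
                 tailEnergy W₁ n ℓ 𝔸 R F w s)) := by
  obtain ⟨C, hC0, hC⟩ := residualX_norm_sq_le_of_pos W₁ hlo hhi hβ
  refine ⟨C, hC0, ?_⟩
  intro n hn 𝔸 h𝔸 hodd T F w h hF ℓ hℓ R hbox t ht
  rcases ht.1.eq_or_lt with h0 | htpos
  · -- `t = 0`
    rw [← h0, intervalIntegral.integral_same, mul_zero, neg_zero, Real.exp_zero, one_mul, add_zero]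
  have hT : 0 < T := htpos.trans_le ht.2
  -- abbreviations for the three real functions of the window start
  set Φ : ℝ → ℝ := fun τ => ‖residualX W₁ n ℓ 𝔸 R F w τ‖ ^ 2 with hΦ
  set G : ℝ → ℝ := fun s => Real.exp (-(Real.pi ^ 2 * lo / 2 * (t - s))) *
      (C * ((Real.sqrt (freqNormSq ℓ) / n) ^ 2 * ‖refState W₁ n ℓ 𝔸 R F w s‖ ^ 2 +
           (Real.sqrt (freqNormSq ℓ) / n) ^ 4 * ‖modeRep W₁ n ((1 / (n : ℝ) ^ 2) • 𝔸) F w ℓ s‖ ^ 2 +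
           (Real.sqrt (freqNormSq ℓ) / n) ^ 4 * ‖sbVec W₁ n ((1 / (n : ℝ) ^ 2) • 𝔸) F w ℓ R s‖ ^ 2 +
           tailEnergy W₁ n ℓ 𝔸 R F w s)) with hG
  -- continuity on `[0,T]`
  have hΦc : ContinuousOn Φ (Icc 0 T) := (((continuousOn_residualX W₁ ℓ h𝔸 hlo R hT.le h)).norm).pow 2
  have hGc : ContinuousOn G (Icc 0 T) := by
    refine (Continuous.continuousOn (by fun_prop)).mul (continuousOn_const.mul
      ((((continuousOn_const.mul ?_).add (continuousOn_const.mul ?_)).add (continuousOn_const.mul ?_)).add ?_))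
    · exact (((continuousOn_refState W₁ ℓ h𝔸 hlo R hT.le h)).norm).pow 2
    · exact (((continuousOn_modeRep W₁ n hT.le h ℓ)).norm).pow 2
    · exact (((continuousOn_sbVec W₁ n hT.le h ℓ R)).norm).pow 2
    · exact continuousOn_tailEnergy W₁ n ℓ 𝔸 R hT.le h
  have hGi : IntegrableOn G (uIcc 0 T) volume := by
    rw [uIcc_of_le hT.le]; exact hGc.integrableOn_Icc
  have hGint : ∀ {c : ℝ}, c ∈ Icc 0 T → IntervalIntegrable G volume 0 c := fun {c} hc =>
    (hGc.mono (by rw [uIcc_of_le hc.1]; exact Icc_subset_Icc_right hc.2)).intervalIntegrable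
  -- the estimate from every `a ∈ (0,t)`, rewritten with `∫_a^t = ∫_0^t − ∫_0^a`
  have hest : ∀ a ∈ Ioo 0 t, Φ t ≤ Real.exp (-(Real.pi ^ 2 * lo / 2 * (t - a))) * Φ a +
      ((∫ s in (0:ℝ)..t, G s) - ∫ s in (0:ℝ)..a, G s) := by
    intro a ha
    have h1 := hC hn h𝔸 hodd h hF hℓ hbox (a := a) ⟨ha.1, ha.2.trans_le ht.2⟩ (t := t) ⟨ha.2.le, ht.2⟩
    rw [intervalIntegral.integral_interval_sub_left (hGint ht) (hGint ⟨ha.1.le, (ha.2.trans_le ht.2).le⟩)]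
    exact h1
  -- the limit `a → 0⁺` of the right-hand side
  have hle : 𝓝[>] (0:ℝ) ≤ 𝓝[Icc 0 T] 0 := nhdsWithin_le_of_mem (Icc_mem_nhdsGT hT)
  have hΦ0 : Tendsto Φ (𝓝[>] 0) (𝓝 (Φ 0)) := ((hΦc 0 ⟨le_rfl, hT.le⟩).tendsto).mono_left hle
  have hexp0 : Tendsto (fun a => Real.exp (-(Real.pi ^ 2 * lo / 2 * (t - a)))) (𝓝[>] 0)
      (𝓝 (Real.exp (-(Real.pi ^ 2 * lo / 2 * (t - 0))))) :=
    ((by fun_prop : Continuous fun a => Real.exp (-(Real.pi ^ 2 * lo / 2 * (t - a)))).tendsto 0).mono_left nhdsWithin_le_nhds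
  have hP0 : Tendsto (fun a => ∫ s in (0:ℝ)..a, G s) (𝓝[>] 0) (𝓝 (∫ s in (0:ℝ)..0, G s)) := by
    have hc := intervalIntegral.continuousOn_primitive_interval (μ := volume) hGi
    rw [uIcc_of_le hT.le] at hc
    exact ((hc 0 ⟨le_rfl, hT.le⟩).tendsto).mono_left hle
  have hlim : Tendsto (fun a => Real.exp (-(Real.pi ^ 2 * lo / 2 * (t - a))) * Φ a + ((∫ s in (0:ℝ)..t, G s) - ∫ s in (0:ℝ)..a, G s))
      (𝓝[>] 0) (𝓝 (Real.exp (-(Real.pi ^ 2 * lo / 2 * (t - 0))) * Φ 0 + ((∫ s in (0:ℝ)..t, G s) - ∫ s in (0:ℝ)..0, G s))) :=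
    (hexp0.mul hΦ0).add (tendsto_const_nhds.sub hP0)
  have hev : ∀ᶠ a in 𝓝[>] (0:ℝ), Φ t ≤ Real.exp (-(Real.pi ^ 2 * lo / 2 * (t - a))) * Φ a +
      ((∫ s in (0:ℝ)..t, G s) - ∫ s in (0:ℝ)..a, G s) :=
    Filter.mem_of_superset (Ioo_mem_nhdsGT htpos) fun a ha => hest a ha
  have hfin := ge_of_tendsto hlim hev
  rw [sub_zero, intervalIntegral.integral_same, sub_zero] at hfin
  exact hfin

end Summit.AnomalousDissipation.AnomalousDissipation.Theorems.SolenoidalFractalHomogenisation.LagrangianStep.Sideband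

end
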